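import Literature.Geometry.Riemannian.HamiltonCurvatureODE
import Literature.Geometry.Riemannian.PinchingEstimates
import Mathlib.Analysis.SpecialFunctions.Log.Basic
import HarnessLib

/-!
# Hamilton's pinching estimates at the level of the curvature ODE (Hamilton 1997, §§2.1–2.2)
(topic `Geometry/Riemannian`)

Second layer (over `HamiltonCurvatureODE.lean`) of the decomposition of
`Literature.Geometry.Riemannian.hamilton_chenZhu_pinching` (`PinchingEstimates.lean`; Chen–Zhu
2006, Lemma 2.1 = Hamilton 1997, Thm. B1.1 + Thm. B2.3). Hamilton proves Thm. B1.1 (p. 7) as a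
corollary (p. 20) of a chain of statements "the inequality … is preserved by the Ricci flow",
each of which is reduced (p. 7, following Hamilton 1986) to: *the inequality, together with
the previously established ones, defines a convex set of curvature matrices `(A, B, C)` which is
forward invariant under the ODE `A' = A² + BᵗB + 2A^#, B' = AB + BC + 2B^#, C' = C² + ᵗBB + 2C^#`*
(`HamiltonODE.field`). This file records the sets (real definitions, in the variational language
of `PinchingEstimates.lean`: extremal eigenvalues / singular values and Ky Fan sums as `min`/`max`
of quadratic forms over unit vectors and orthonormal pairs of `ℝ³`); the ODE-level invariance
statements take the logical form `HamiltonODE.IsInvariantRel field K Z` ("if the previous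
estimates `K` hold, `Z` is preserved").

## Contents (sets; `p = (A, B, C) : HamiltonODE.Blocks`)

* `Matrix.TwoSmallestEigenvaluesSumGE A m` — `a₁ + a₂ ≥ m` (closed form of
  `Matrix.TwoSmallestEigenvaluesSumGT`, Thm. 1.2).
* `HamiltonODE.SingularValuesSumSqLE p Λ` — `(b₂ + b₃)² ≤ Λ (a₁ + a₂)(c₁ + c₂)` (Thm. 1.3).
* `Matrix.TwoLargestEigenvaluesSumLE A Φ` — `a₂ + a₃ ≤ Φ (a₁ + a₂)` (Thm. 1.4).
* `HamiltonODE.MaxLEPairSum p Ξ` — `max(a₃, b₃, c₃) ≤ Ξ (a₁ + a₂)` and `≤ Ξ (c₁ + c₂)` (Cor. 1.5).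
* `Matrix.SmallestEigenvalueAddNonneg A ρ` — `a₁ + ρ ≥ 0` (Thm. 1.6, closed form).
* `Matrix.LargestLESmallestAdd A Ψ ρ` — `a₃ ≤ Ψ (a₁ + ρ)` (Thm. 1.7).
* (`Matrix.PinchedBy A B C ρ Ω` of `PinchingEstimates.lean` — Cor. 1.8 = (2.1)–(2.2).)
* `HamiltonODE.SingularValueLEExp p H P ρ t` — `b₃ ≤ H e^{Pt} √((a₁+ρ)(c₁+ρ))` (Thm. 1.9).
* `HamiltonODE.ImprovedPinching p K` — `2b₃ ≤ (1 + K / max{ln √x, 2}) √x`,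
  `x = (a₁+a₂)(c₁+c₂)` (Thm. 2.1).
* `HamiltonODE.ImprovedPinchingQ p ρ L P Q t` — `b₃ ≤ (1 + L e^{Pt}/max{ln √u², Q}) u`,
  `u² = (a₁+ρ)(c₁+ρ)` (Thm. 2.3; `Matrix.ImprovedPinchingAt` is the case `Q = 2`).

## The ODE-level statements (not vended here)

Hamilton's eight invariance theorems (Thms. 1.2, 1.3, 1.4, 1.6, 1.7, 1.9, 2.1 with Lemma 2.2, 2.3)
are statements `HamiltonODE.IsInvariantRel field K Z` about these sets, with `K` the "previous
estimates" each printed proof uses (always including the phase-space constraint that `A` and `C`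
are symmetric — Hamilton's `M` is a symmetric form on `Λ²`; for non-symmetric `A` the estimates
fail — and, where the proof uses the first Bianchi identity, the linear constraint
`tr A = tr C`). They are not proved in the tree yet and, by the fact-decomposition discipline,
are not vended as named facts either: `PinchingEstimatesAssembly.lean` takes them as explicit
hypotheses of the proved reduction of `hamilton_chenZhu_pinching`. Corollaries 1.5 and 1.8 are
algebra and are proved in `PinchingEstimatesAlgebra.lean`; convexity / closedness of the sets in
`PinchingSetsConvexity.lean`.

## Design notes

* Variational forms are equivalent to the eigenvalue statements on the constraint sets where they
  are used (`a₁ + a₂ > 0`, `c₁ + c₂ > 0`, so that products of minima are minima of products; the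
  right-hand sides of Thms. 2.1/2.3 are increasing in `x` resp. `u`, cf. `PinchingEstimates.lean`).
* All sets depend on `B` only through `max`-expressions symmetric under `B ↦ -B`, as required by
  `hamilton_maximumPrinciple_curvatureODE` (sign of the `B^#` term, see `HamiltonCurvatureODE.lean`).

## References

* R. S. Hamilton, *Four-manifolds with positive isotropic curvature*, Comm. Anal. Geom. 5 (1997)
  1–92, §2.1 (Thms. 1.1–1.9, Cors. 1.5, 1.8, pp. 7–13), §2.2 (Thm. 2.1, Lemma 2.2, Thm. 2.3 and
  the proof of Thm. 1.1, pp. 13–21). [Hamilton1997]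
* R. S. Hamilton, J. Differential Geom. 24 (1986), §6, p. 166 (the ODE; `tr A = tr C` is
  preserved), Lemma 6.1 (the differential inequalities for `a₁, a₃, b₂ + b₃, c₁, c₃`). [Hamilton1986]
* B.-L. Chen, X.-P. Zhu, J. Differential Geom. 74 (2006), §2, Lemma 2.1, (2.1)–(2.3). [ChenZhu2006]
-/

noncomputable section

open Set Real
open scoped Matrix

/-! ### Variational eigenvalue predicates on `3 × 3` matrices -/

namespace Matrix

variable (A : Matrix (Fin 3) (Fin 3) ℝ)

/-- **`a₁ + a₂ ≥ m`** (closed Ky Fan form): `uᵀAu + vᵀAv ≥ m` for all orthonormal pairs `u, v`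
of `ℝ³` (Hamilton 1997, Thm. 1.2: "`a₁ + a₂ ≥ m` is preserved"). Deliberate extension of
Mathlib's `Matrix` namespace, like `Matrix.TwoSmallestEigenvaluesSumGT`. [cite: Hamilton1997, §2.1, Thm. 1.2 (p. 7)] -/
def TwoSmallestEigenvaluesSumGE (m : ℝ) : Prop :=
  ∀ u v : Fin 3 → ℝ, u ⬝ᵥ u = 1 → v ⬝ᵥ v = 1 → u ⬝ᵥ v = 0 → m ≤ u ⬝ᵥ (A *ᵥ u) + v ⬝ᵥ (A *ᵥ v)

/-- **`a₂ + a₃ ≤ Φ (a₁ + a₂)`** (Ky Fan: `a₂ + a₃ = max`, `a₁ + a₂ = min` of `uᵀAu + vᵀAv` over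
orthonormal pairs): for all orthonormal pairs `(u, v)` and `(w, w')`,
`uᵀAu + vᵀAv ≤ Φ (wᵀAw + w'ᵀAw')` (Hamilton 1997, Thm. 1.4). [cite: Hamilton1997, §2.1, Thm. 1.4 (p. 8)] -/
def TwoLargestEigenvaluesSumLE (Φ : ℝ) : Prop :=
  ∀ u v w w' : Fin 3 → ℝ, u ⬝ᵥ u = 1 → v ⬝ᵥ v = 1 → u ⬝ᵥ v = 0 →
    w ⬝ᵥ w = 1 → w' ⬝ᵥ w' = 1 → w ⬝ᵥ w' = 0 →
      u ⬝ᵥ (A *ᵥ u) + v ⬝ᵥ (A *ᵥ v) ≤ Φ * (w ⬝ᵥ (A *ᵥ w) + w' ⬝ᵥ (A *ᵥ w'))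

/-- **`a₁ + ρ ≥ 0`**: `wᵀAw + ρ ≥ 0` for all unit `w` (Hamilton 1997, Thm. 1.6: "`a₁ + ρ > 0` is
preserved"; the proof — `a₁` is non-decreasing along the ODE once `a₁ + a₂ > 0` — gives the
closed form as well). [cite: Hamilton1997, §2.1, Thm. 1.6 (p. 10)] -/
def SmallestEigenvalueAddNonneg (ρ : ℝ) : Prop :=
  ∀ w : Fin 3 → ℝ, w ⬝ᵥ w = 1 → 0 ≤ w ⬝ᵥ (A *ᵥ w) + ρ

/-- **`a₃ ≤ Ψ (a₁ + ρ)`**: `uᵀAu ≤ Ψ (wᵀAw + ρ)` for all unit `u, w` (Hamilton 1997, Thm. 1.7).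
[cite: Hamilton1997, §2.1, Thm. 1.7 (pp. 10–11)] -/
def LargestLESmallestAdd (Ψ ρ : ℝ) : Prop :=
  ∀ u w : Fin 3 → ℝ, u ⬝ᵥ u = 1 → w ⬝ᵥ w = 1 → u ⬝ᵥ (A *ᵥ u) ≤ Ψ * (w ⬝ᵥ (A *ᵥ w) + ρ)

end Matrix

namespace Literature.Geometry.Riemannian

namespace HamiltonODE

variable (p : Blocks)

/-- **`(b₂ + b₃)² ≤ Λ (a₁ + a₂)(c₁ + c₂)`** (Hamilton 1997, Thm. 1.3), variationally: `b₂ + b₃`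
is the maximum of `u₁ᵀBv₁ + u₂ᵀBv₂` over orthonormal pairs `(u₁, u₂)`, `(v₁, v₂)` (Ky Fan for
singular values), and on `a₁ + a₂ > 0`, `c₁ + c₂ > 0` the product of the minima is the minimum
of the products. [cite: Hamilton1997, §2.1, Thm. 1.3 (pp. 7–8)] -/
def SingularValuesSumSqLE (Λ : ℝ) : Prop :=
  ∀ u₁ u₂ v₁ v₂ w w' z z' : Fin 3 → ℝ,
    u₁ ⬝ᵥ u₁ = 1 → u₂ ⬝ᵥ u₂ = 1 → u₁ ⬝ᵥ u₂ = 0 → v₁ ⬝ᵥ v₁ = 1 → v₂ ⬝ᵥ v₂ = 1 → v₁ ⬝ᵥ v₂ = 0 →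
    w ⬝ᵥ w = 1 → w' ⬝ᵥ w' = 1 → w ⬝ᵥ w' = 0 → z ⬝ᵥ z = 1 → z' ⬝ᵥ z' = 1 → z ⬝ᵥ z' = 0 →
      (u₁ ⬝ᵥ (p.2.1 *ᵥ v₁) + u₂ ⬝ᵥ (p.2.1 *ᵥ v₂)) ^ 2 ≤
        Λ * (w ⬝ᵥ (p.1 *ᵥ w) + w' ⬝ᵥ (p.1 *ᵥ w')) * (z ⬝ᵥ (p.2.2 *ᵥ z) + z' ⬝ᵥ (p.2.2 *ᵥ z'))

/-- **`max(a₃, b₃, c₃) ≤ Ξ (a₁ + a₂)` and `≤ Ξ (c₁ + c₂)`** (the conclusion of Hamilton 1997,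
Cor. 1.5), variationally: for all unit `u, v` and orthonormal pairs `(w, w')`, each of
`uᵀAu, uᵀBv, uᵀCu` is `≤ Ξ (wᵀAw + w'ᵀAw')` and `≤ Ξ (wᵀCw + w'ᵀCw')`.
[cite: Hamilton1997, §2.1, Cor. 1.5 (pp. 9–10)] -/
def MaxLEPairSum (Ξ : ℝ) : Prop :=
  ∀ u v w w' : Fin 3 → ℝ, u ⬝ᵥ u = 1 → v ⬝ᵥ v = 1 → w ⬝ᵥ w = 1 → w' ⬝ᵥ w' = 1 → w ⬝ᵥ w' = 0 →
    (u ⬝ᵥ (p.1 *ᵥ u) ≤ Ξ * (w ⬝ᵥ (p.1 *ᵥ w) + w' ⬝ᵥ (p.1 *ᵥ w')) ∧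
      u ⬝ᵥ (p.2.1 *ᵥ v) ≤ Ξ * (w ⬝ᵥ (p.1 *ᵥ w) + w' ⬝ᵥ (p.1 *ᵥ w')) ∧
      u ⬝ᵥ (p.2.2 *ᵥ u) ≤ Ξ * (w ⬝ᵥ (p.1 *ᵥ w) + w' ⬝ᵥ (p.1 *ᵥ w'))) ∧
    (u ⬝ᵥ (p.1 *ᵥ u) ≤ Ξ * (w ⬝ᵥ (p.2.2 *ᵥ w) + w' ⬝ᵥ (p.2.2 *ᵥ w')) ∧
      u ⬝ᵥ (p.2.1 *ᵥ v) ≤ Ξ * (w ⬝ᵥ (p.2.2 *ᵥ w) + w' ⬝ᵥ (p.2.2 *ᵥ w')) ∧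
      u ⬝ᵥ (p.2.2 *ᵥ u) ≤ Ξ * (w ⬝ᵥ (p.2.2 *ᵥ w) + w' ⬝ᵥ (p.2.2 *ᵥ w')))

/-- **`b₃ ≤ H e^{Pt} √((a₁ + ρ)(c₁ + ρ))`** (Hamilton 1997, Thm. 1.9), variationally over unit
`u, v` (for `b₃`) and unit `w, z` (for `a₁`, `c₁`; the right-hand side is monotone).
[cite: Hamilton1997, §2.1, Thm. 1.9 (p. 12)] -/
def SingularValueLEExp (H P ρ t : ℝ) : Prop :=
  ∀ u v w z : Fin 3 → ℝ, u ⬝ᵥ u = 1 → v ⬝ᵥ v = 1 → w ⬝ᵥ w = 1 → z ⬝ᵥ z = 1 →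
    u ⬝ᵥ (p.2.1 *ᵥ v) ≤ H * exp (P * t) * sqrt ((w ⬝ᵥ (p.1 *ᵥ w) + ρ) * (z ⬝ᵥ (p.2.2 *ᵥ z) + ρ))

/-- **Improving pinching, first form** (Hamilton 1997, Thm. 2.1):
`2b₃ / √((a₁+a₂)(c₁+c₂)) ≤ 1 + K / max{ln √((a₁+a₂)(c₁+c₂)), 2}`, variationally with
`x = (wᵀAw + w'ᵀAw')(zᵀCz + z'ᵀCz')` over orthonormal pairs in place of `(a₁+a₂)(c₁+c₂)` (the
right-hand side `(1 + K/max{ln √x, 2}) √x` is increasing in `x` for `K ≥ 0`).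
[cite: Hamilton1997, §2.2, Thm. 2.1 (p. 13)] -/
def ImprovedPinching (K : ℝ) : Prop :=
  ∀ u v w w' z z' : Fin 3 → ℝ, u ⬝ᵥ u = 1 → v ⬝ᵥ v = 1 →
    w ⬝ᵥ w = 1 → w' ⬝ᵥ w' = 1 → w ⬝ᵥ w' = 0 → z ⬝ᵥ z = 1 → z' ⬝ᵥ z' = 1 → z ⬝ᵥ z' = 0 →
      2 * (u ⬝ᵥ (p.2.1 *ᵥ v)) ≤
        (1 + K / max (log (sqrt ((w ⬝ᵥ (p.1 *ᵥ w) + w' ⬝ᵥ (p.1 *ᵥ w')) *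
            (z ⬝ᵥ (p.2.2 *ᵥ z) + z' ⬝ᵥ (p.2.2 *ᵥ z'))))) 2) *
          sqrt ((w ⬝ᵥ (p.1 *ᵥ w) + w' ⬝ᵥ (p.1 *ᵥ w')) * (z ⬝ᵥ (p.2.2 *ᵥ z) + z' ⬝ᵥ (p.2.2 *ᵥ z')))

/-- **Improving pinching, second form** (Hamilton 1997, Thm. 2.3):
`b₃ / √((a₁+ρ)(c₁+ρ)) ≤ 1 + L e^{Pt} / max{ln √((a₁+ρ)(c₁+ρ)), Q}`, variationally as in
`Matrix.ImprovedPinchingAt` (which is the case `Q = 2`, Chen–Zhu 2006, (2.3)).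
[cite: Hamilton1997, §2.2, Thm. 2.3 (p. 17)] -/
def ImprovedPinchingQ (ρ L P Q t : ℝ) : Prop :=
  ∀ u v w w' : Fin 3 → ℝ, u ⬝ᵥ u = 1 → v ⬝ᵥ v = 1 → w ⬝ᵥ w = 1 → w' ⬝ᵥ w' = 1 →
    u ⬝ᵥ (p.2.1 *ᵥ v) ≤
      (1 + L * exp (P * t) /
          max (log (sqrt ((w ⬝ᵥ (p.1 *ᵥ w) + ρ) * (w' ⬝ᵥ (p.2.2 *ᵥ w') + ρ)))) Q) *
        sqrt ((w ⬝ᵥ (p.1 *ᵥ w) + ρ) * (w' ⬝ᵥ (p.2.2 *ᵥ w') + ρ))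

variable {p}

/-- `ImprovedPinchingQ` with `Q = 2` is literally `Matrix.ImprovedPinchingAt`. [folklore] -/
theorem improvedPinchingQ_two_iff (ρ L P t : ℝ) :
    ImprovedPinchingQ p ρ L P 2 t ↔ Matrix.ImprovedPinchingAt p.1 p.2.1 p.2.2 ρ L P t :=
  Iff.rfl

/-- Raising `Q` above `2` only shrinks the set: Hamilton's Thm. 2.3 with any `Q ≥ 2` gives
Chen–Zhu's (2.3) (`max{·, Q} ≥ max{·, 2} > 0`, `L e^{Pt} ≥ 0`, `√· ≥ 0`). [cite: ChenZhu2006, §2, Lemma 2.1, (2.3)] -/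
theorem ImprovedPinchingQ.improvedPinchingAt {ρ L P Q t : ℝ} (h : ImprovedPinchingQ p ρ L P Q t)
    (hL : 0 ≤ L) (hQ : 2 ≤ Q) : Matrix.ImprovedPinchingAt p.1 p.2.1 p.2.2 ρ L P t := by
  intro u v w w' hu hv hw hw'
  refine (h u v w w' hu hv hw hw').trans (mul_le_mul_of_nonneg_right ?_ (sqrt_nonneg _))
  have hLe : 0 ≤ L * exp (P * t) := mul_nonneg hL (exp_pos _).le
  have h2 : (0 : ℝ) < max (log (sqrt ((w ⬝ᵥ (p.1 *ᵥ w) + ρ) * (w' ⬝ᵥ (p.2.2 *ᵥ w') + ρ)))) 2 :=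
    lt_max_of_lt_right two_pos
  have hQ' : max (log (sqrt ((w ⬝ᵥ (p.1 *ᵥ w) + ρ) * (w' ⬝ᵥ (p.2.2 *ᵥ w') + ρ)))) 2 ≤
      max (log (sqrt ((w ⬝ᵥ (p.1 *ᵥ w) + ρ) * (w' ⬝ᵥ (p.2.2 *ᵥ w') + ρ)))) Q :=
    max_le_max_left _ hQ
  gcongr

end HamiltonODE

end Literature.Geometry.Riemannian

end
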